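/-
Copyright: the b2b-balaban T⁴-continuum CRUX team, row NE7b OWNER lineage `t4-ne7b-p1` (gen 125). Project licence.
-/
import Summits.QuantumFields.BalabanUV.T4Continuum.Spine.NE7b.SupZdPerturbedCoarseTorusSeam

/-!
# THE ROW FORM OF THE PERTURBED SEAM ESTIMATE: for EVERY pair of coarse torus points `y, y′` (no depth hypothesis), the torus `H + K` block
# column `ψ_{y′}` and the `ℤ^d` column `Φ_{wm y′}` satisfy, on the block of `wm y`,
# `|ψ_{y′}(σ q) − Φ_{wm y′}(q)| ≤ C′·e^{−(μ∕4)·max(0, 3^k∕2 − 2 − |wm y|₁)}`, and so do the coarse entries `T^{tor}_K(y,y′) − T_K(wm y, wm y′)` —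
# exponentially small in the depth of the ROW below the seam, uniformly in the column, with `C′` explicit in `(C_P, δ₀, μ, γ, ε, λ, Λ, B_u,
# C_Φ)`: the truncation defect `Σ_{q ∉ W}K(p,q)Φ(q)` is ITSELF small in the depth of `p` (non-window points lie in non-deep blocks, (238)), so
# (237) is applied on the blocks deeper than HALF the row's depth.  The exact `H + K` twin of (197) `coarse_seam_row` — the shape [B4] (5.9)
# consumes (row nodes) (row NE7b, node U5c; (237)∕(238)∕(239) BY NAME; [folklore])

Cell `pub-balaban`, sub-cell `t4`, spine estimate NE7b (`T4WeightBudget.RelWeightBound`; the cell's OWN estimate — NOT PRINTED in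
[Bałaban 1983–89], NOT PROVED).  Crux-route work under `Spine/NE7b/` by the row OWNER (`t4-ne7b-p1` gen 125, file (240)) under FREEZE
(0)'s crux-prover clause; NOTHING of Bałaban's is named as a Lean object, valued or asserted; no `T4Continuum/Support` leaf typed; no `def`,
no notation; zero `sorry`.  Imports (BY NAME): the OWNER's (239) `…SupZdPerturbedCoarseTorusSeam` (import closure: (237)
`zd_perturbed_data_agreement`, (238) `lift_truncated_equation`, `column_truncated_equation`, `truncated_kernel_decay`, `nonwindow_block_far`,
(215) `blockDist_le_l1`, (197) `windowMap_siteOf_of_deep`, `windowMap_siteOf_of_deep_block`, `depth_le_dist`, `torusNorm_eq_l1`, (194)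
`l1_triangle`, (189) `summable_exp_l1`, `tsum_exp_l1_le`, (191) `natAbs_sub_comm_sum`, (222) `K_pos`, (27) `mem_B`, `sum_B`, `sum_B_const`).

WHY (located).  (239)'s bound has a column term `εK_γC_Φe^{−μR_k(c)}` because the truncation defect was bounded uniformly; [B4] (5.9),
through (198)'s geometric mean of a row bound, a column bound (symmetry) and plain decay, wants a bound in the ROW depth alone, as (197)
delivered for the linear column.  The defect at `p` only involves non-window `q`, whose blocks are non-deep, hence at block distance
`≥ R_k(blk n p)` and fine distance `≥ R_k(blk n p) − d` ((215)); half of `γ` pays for it: `|g₂(p)| ≤ εK_{γ∕2}e^{(γ∕2)d}C_Φe^{−(γ∕2)R_k(blk n p)}`.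
Taking `A` = the deep blocks of depth `≥ D₀ = max(0, R_k(wm y)∕2)`, the sources are `η = εK_{γ∕2}e^{(γ∕2)d}C_Φe^{−(γ∕2)D₀}`-close on `A`, and
every `c′ ∉ A` is at `ℓ¹` distance `≥ D₀` from `wm y` (non-deep: (197); shallow: reverse triangle) — so (237) gives `C_∞η + C_∞′e^{−(μ∕2)D₀}`.

WHAT IS PROVED ([folklore]): §1 **`truncation_defect_depth`** (the pointwise defect bound in the depth of `p`), `far_from_shallow` (the
distance bookkeeping for `c′ ∉ A`); §2 THE END **`zd_perturbed_coarse_seam_row`** (`∃ C₀ C_P δ₀ > 0`: for ALL `n, k`, `V`, rates∕sizes under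
the two smallness conditions, kernels of the class, ANY bounded torus column family `ψ` and ANY bounded `ℤ^d` column family `Φ`:
the pointwise and the coarse-entry row bounds for ALL `y, y′`); §3 toy.

HONEST (what this is NOT).  The row form only; Hyp56 for `T^{tor}_K`, Hyp59 and [B4] (5.10) on the torus, and the limit `(T^{tor}_K)⁻¹ → N_K`
are the sequel ((198)∕(199)'s pattern with (236)); scalar skeleton ((A3), NC-NE7b-α UNRULED); nothing of the covariant propagators of
[B4]–[B6]; nothing of Bałaban's asserted.  BY-NAME EFFECT ON THE WALL: NONE.  NE7b NOT PRINTED ∕ NOT PROVED; spine PROVED 0∕9; rung (B)+1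
— the programme's measures remain FINITE-torus statements; NOT the mass gap, NOT Clay.  HONEST DEPENDENCY: continuum YM on T⁴ ⇐ BetaPertH
∧ nine spine estimates (0∕9 proved); BetaPertH ⇐ (D1) ∧ (D4) ∧ CAP+tail; G-an2-4 gates asym, D1 and NE2∕3∕4.
-/

set_option autoImplicit false

noncomputable section

namespace Summit.QuantumFields.BalabanUV.T4Continuum.NE7b.SupZdPerturbedCoarseTorusSeamRow

open Real Filter Topology
open Literature.MathematicalPhysics.QuantumFieldTheory.Balaban1983to89
open B6QGQLower276 (X e blk B chart mem_B sum_B sum_B_const blk_chart)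
open Beta (Site siteOf windowMap siteOf_windowMap)
open SupZdExponentialSums (summable_exp_l1 tsum_exp_l1_le)
open SupZdCoarseForm (natAbs_sub_comm_sum)
open SupZdCoarseInverse (l1_triangle)
open SupZdPerturbedDecay (blockDist_le_l1)
open SupZdPerturbedColumn (K_pos)
open SupZdCoarseTorusSeam (windowMap_siteOf_of_deep windowMap_siteOf_of_deep_block depth_le_dist torusNorm_eq_l1)
open SupZdPerturbedDataAgreement (zd_perturbed_data_agreement)
open SupZdPerturbedTorusLift (lift_truncated_equation column_truncated_equation truncated_kernel_decay torus_coarse_entry_reading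
  nonwindow_block_far)

variable {d : ℕ}

/-! ## §1. The truncation defect is small in the depth of the point; shallow points are far from deep rows -/

/-- **THE TRUNCATION DEFECT DECAYS WITH THE DEPTH**: `|Φ| ≤ C_Φ`, `|K(p,q)| ≤ εe^{−γ|p−q|₁}` ⟹
`|Σ′_q𝟙[q ∉ W]K(p,q)Φ(q)| ≤ εK_{γ∕2}e^{(γ∕2)d}C_Φ·e^{−(γ∕2)(3^k∕2 − 2 − |blk n p|₁)}` — non-window `q` have non-deep blocks ((238)), at block
distance `≥` the depth of `blk n p` ((197)) and fine distance `≥` that minus `d` ((215)). [folklore] -/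
theorem truncation_defect_depth (n k : ℕ) {ε γ CΦ : ℝ} (hε : 0 ≤ ε) (hγ : 0 < γ) (K : X d → X d → ℝ)
    (hK : ∀ p q, |K p q| ≤ ε * exp (-(γ * ∑ i, (((p i - q i).natAbs : ℕ) : ℝ)))) (Φ : X d → ℝ) (hΦ : ∀ q, |Φ q| ≤ CΦ) (p : X d) :
    |(-∑' q : X d, (if windowMap d ((n + 1) * 3 ^ k) (siteOf d ((n + 1) * 3 ^ k) q) = q then 0 else K p q) * Φ q)|
      ≤ ε * (2 * (1 - exp (-(γ / 2)))⁻¹) ^ d * exp (γ / 2 * d) * CΦ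
        * exp (-(γ / 2 * (((3 ^ k : ℕ) : ℝ) / 2 - 2 - ∑ j, (((blk n p j).natAbs : ℕ) : ℝ)))) := by
  classical
  have hCΦ : 0 ≤ CΦ := (abs_nonneg _).trans (hΦ p)
  have hγ2 : 0 < γ / 2 := by linarith
  obtain ⟨A, hA⟩ : ∃ A : ℝ, A = ε * exp (γ / 2 * d) * CΦ
      * exp (-(γ / 2 * (((3 ^ k : ℕ) : ℝ) / 2 - 2 - ∑ j, (((blk n p j).natAbs : ℕ) : ℝ)))) := ⟨_, rfl⟩
  have hA0 : 0 ≤ A := by rw [hA]; positivity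
  -- termwise bound
  have hpt : ∀ q, |(if windowMap d ((n + 1) * 3 ^ k) (siteOf d ((n + 1) * 3 ^ k) q) = q then 0 else K p q) * Φ q|
      ≤ A * exp (-(γ / 2 * ∑ i, (((p i - q i).natAbs : ℕ) : ℝ))) := by
    intro q
    split_ifs with hq
    · rw [zero_mul, abs_zero]; positivity
    · rw [abs_mul]
      have h1 := nonwindow_block_far n k q (blk n p) hq
      have h2 := blockDist_le_l1 n q p
      rw [natAbs_sub_comm_sum q p] at h2
      have hdist : ((3 ^ k : ℕ) : ℝ) / 2 - 2 - ∑ j, (((blk n p j).natAbs : ℕ) : ℝ) ≤ ∑ i, (((p i - q i).natAbs : ℕ) : ℝ) + d := by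
        linarith
      have hexp : exp (-(γ * ∑ i, (((p i - q i).natAbs : ℕ) : ℝ))) ≤ exp (γ / 2 * d)
          * exp (-(γ / 2 * (((3 ^ k : ℕ) : ℝ) / 2 - 2 - ∑ j, (((blk n p j).natAbs : ℕ) : ℝ))))
          * exp (-(γ / 2 * ∑ i, (((p i - q i).natAbs : ℕ) : ℝ))) := by
        rw [← exp_add, ← exp_add]; exact exp_le_exp.2 (by nlinarith)
      calc |K p q| * |Φ q| ≤ ε * exp (-(γ * ∑ i, (((p i - q i).natAbs : ℕ) : ℝ))) * CΦ := mul_le_mul (hK p q) (hΦ q) (abs_nonneg _)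
            ((abs_nonneg _).trans (hK p q))
        _ ≤ ε * (exp (γ / 2 * d) * exp (-(γ / 2 * (((3 ^ k : ℕ) : ℝ) / 2 - 2 - ∑ j, (((blk n p j).natAbs : ℕ) : ℝ))))
            * exp (-(γ / 2 * ∑ i, (((p i - q i).natAbs : ℕ) : ℝ)))) * CΦ :=
            mul_le_mul_of_nonneg_right (mul_le_mul_of_nonneg_left hexp hε) hCΦ
        _ = A * exp (-(γ / 2 * ∑ i, (((p i - q i).natAbs : ℕ) : ℝ))) := by rw [hA]; ring
  have hmaj : Summable fun q : X d => A * exp (-(γ / 2 * ∑ i, (((p i - q i).natAbs : ℕ) : ℝ))) := (summable_exp_l1 hγ2 p).mul_left A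
  have hs : Summable fun q : X d => (if windowMap d ((n + 1) * 3 ^ k) (siteOf d ((n + 1) * 3 ^ k) q) = q then 0 else K p q) * Φ q :=
    Summable.of_norm_bounded hmaj fun q => by rw [Real.norm_eq_abs]; exact hpt q
  rw [abs_neg]
  have h1 : |∑' q : X d, (if windowMap d ((n + 1) * 3 ^ k) (siteOf d ((n + 1) * 3 ^ k) q) = q then 0 else K p q) * Φ q|
      ≤ ∑' q : X d, |(if windowMap d ((n + 1) * 3 ^ k) (siteOf d ((n + 1) * 3 ^ k) q) = q then 0 else K p q) * Φ q| := by
    have := norm_tsum_le_tsum_norm hs.norm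
    simpa only [Real.norm_eq_abs] using this
  have h2 := hs.abs.tsum_le_tsum hpt hmaj
  have h3 : ∑' q : X d, A * exp (-(γ / 2 * ∑ i, (((p i - q i).natAbs : ℕ) : ℝ))) ≤ A * (2 * (1 - exp (-(γ / 2)))⁻¹) ^ d := by
    rw [tsum_mul_left]; exact mul_le_mul_of_nonneg_left (tsum_exp_l1_le hγ2 p) hA0
  calc _ ≤ A * (2 * (1 - exp (-(γ / 2)))⁻¹) ^ d := h1.trans (h2.trans h3)
    _ = _ := by rw [hA]; ring

/-- **SHALLOW OR NON-DEEP COARSE POINTS ARE FAR FROM A DEEP ROW**: with `R₀ = 3^k∕2 − 2 − |b₀|₁` and `D₀ = max(0, R₀∕2)`, every `c′` that is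
not deep or has depth `< D₀` satisfies `D₀ ≤ |b₀ − c′|₁`. [folklore] -/
theorem far_from_shallow (k : ℕ) (b₀ c' : X d)
    (hc' : ¬ ((∀ i, 2 * |c' i| + 4 < ((3 ^ k : ℕ) : ℤ)) ∧
      max 0 ((((3 ^ k : ℕ) : ℝ) / 2 - 2 - ∑ j, (((b₀ j).natAbs : ℕ) : ℝ)) / 2)
        ≤ ((3 ^ k : ℕ) : ℝ) / 2 - 2 - ∑ j, (((c' j).natAbs : ℕ) : ℝ))) :
    max 0 ((((3 ^ k : ℕ) : ℝ) / 2 - 2 - ∑ j, (((b₀ j).natAbs : ℕ) : ℝ)) / 2) ≤ ∑ j, (((b₀ j - c' j).natAbs : ℕ) : ℝ) := by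
  have h0 : (0 : ℝ) ≤ ∑ j, (((b₀ j - c' j).natAbs : ℕ) : ℝ) := by positivity
  by_cases hdeep : ∀ i, 2 * |c' i| + 4 < ((3 ^ k : ℕ) : ℤ)
  · -- deep but shallow relative to `D₀`: reverse triangle inequality
    have hlt : ((3 ^ k : ℕ) : ℝ) / 2 - 2 - ∑ j, (((c' j).natAbs : ℕ) : ℝ)
        < max 0 ((((3 ^ k : ℕ) : ℝ) / 2 - 2 - ∑ j, (((b₀ j).natAbs : ℕ) : ℝ)) / 2) := by
      by_contra h; exact hc' ⟨hdeep, not_lt.1 h⟩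
    have htri := l1_triangle c' b₀ (0 : X d)
    have e1 : ∑ j, (((c' j - (0 : X d) j).natAbs : ℕ) : ℝ) = ∑ j, (((c' j).natAbs : ℕ) : ℝ) :=
      Finset.sum_congr rfl fun j _ => by simp
    have e2 : ∑ j, (((b₀ j - (0 : X d) j).natAbs : ℕ) : ℝ) = ∑ j, (((b₀ j).natAbs : ℕ) : ℝ) :=
      Finset.sum_congr rfl fun j _ => by simp
    rw [e1, e2, natAbs_sub_comm_sum c' b₀] at htri
    rcases le_or_gt (((3 ^ k : ℕ) : ℝ) / 2 - 2 - ∑ j, (((b₀ j).natAbs : ℕ) : ℝ)) 0 with hR | hR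
    · rw [max_eq_left (by linarith)]; exact h0
    · rw [max_eq_right (by linarith)] at hlt ⊢
      linarith
  · -- non-deep: (197)'s seam depth
    have h := depth_le_dist k b₀ c' hdeep
    rcases le_or_gt (((3 ^ k : ℕ) : ℝ) / 2 - 2 - ∑ j, (((b₀ j).natAbs : ℕ) : ℝ)) 0 with hR | hR
    · rw [max_eq_left (by linarith)]; exact h0
    · rw [max_eq_right (by linarith)]; linarith

/-! ## §2. THE END: the row form of the seam estimate -/

/-- **HEADLINE — THE SEAM ESTIMATE, ROW FORM, FOR ALL PAIRS OF COARSE TORUS POINTS.**  `d ≥ 3`, `a > 0`, `λ < min(2,a)`, `Λ ≥ 0` ⟹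
`∃ C₀ C_P δ₀ > 0` (from `(d, a, λ, Λ)`) such that for ALL `n, k`, `V : ℤ^d → [−λ, Λ]`, rates `0 < μ < min(δ₀, γ)`, sizes `ε ≥ 0` under the two
smallness conditions, kernels `|K(p,q)| ≤ εe^{−γ|p−q|₁}`, ANY bounded torus column family `|ψ_{y′}| ≤ B_u` solving the torus block-column
equations of `H[V∘wm] + K(wm·,wm·)`, and ANY bounded `ℤ^d` column family `|Φ_c| ≤ C_Φ` solving `(H_V + K)Φ_c = 𝟙[blk n · = c]`: for ALL `y, y′` and
every `q ∈ B n (wm y)`, with `C_∞ = 2C_PK_{δ₀−μ}K_{μ∕2}`, `M = 1 + 2εK_γ(B_u + C_Φ)`, `R(y) = 3^k∕2 − 2 − |wm y|₁`: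
`|ψ_{y′}(σ q) − Φ_{wm y′}(q)| ≤ (C_∞εK_{γ∕2}e^{(γ∕2)d}C_Φ + C_∞(2 + 2(|λ|+Λ)C_∞)M)·e^{−(μ∕2)·max(0, R(y)∕2)}`, and the same bound for
`|T^{tor}_K(y,y′) − T_K(wm y, wm y′)|` — (237) on the blocks deeper than `max(0, R(y)∕2)`. [folklore] -/
theorem zd_perturbed_coarse_seam_row (hd : 3 ≤ d) (a : ℝ) (ha : 0 < a) {lam Lam : ℝ} (hlam : lam < min 2 a) (hLam : 0 ≤ Lam) :
    ∃ C₀ CP δ₀ : ℝ, 0 < C₀ ∧ 0 < CP ∧ 0 < δ₀ ∧ ∀ (n k : ℕ) (V : X d → ℝ), (∀ p, -lam ≤ V p) → (∀ p, V p ≤ Lam) →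
      ∀ (ε γ μ : ℝ), 0 ≤ ε → 0 < μ → μ < δ₀ → μ < γ →
      ε * (2 * (1 - exp (-γ))⁻¹) ^ d * C₀ ≤ 1 / 2 →
      (CP * (2 * (1 - exp (-(δ₀ - μ)))⁻¹) ^ d) * (ε * exp (μ * d) * (2 * (1 - exp (-(γ - μ)))⁻¹) ^ d) ≤ 1 / 2 →
      ∀ (K : X d → X d → ℝ), (∀ p q, |K p q| ≤ ε * exp (-(γ * ∑ i, (((p i - q i).natAbs : ℕ) : ℝ)))) →
      ∀ (ψ : Site d (3 ^ k) → Site d ((n + 1) * 3 ^ k) → ℝ) (Bu : ℝ), (∀ y' x, |ψ y' x| ≤ Bu) →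
      (∀ (y' : Site d (3 ^ k)) (x : Site d ((n + 1) * 3 ^ k)),
        ((n : ℝ) + 1) ^ 2 * ∑ μ', (2 * ψ y' x - ψ y' (x + siteOf d ((n + 1) * 3 ^ k) (e μ')) - ψ y' (x - siteOf d ((n + 1) * 3 ^ k) (e μ')))
        + a / ((n : ℝ) + 1) ^ d * ∑ q ∈ B n (blk n (windowMap d ((n + 1) * 3 ^ k) x)), ψ y' (siteOf d ((n + 1) * 3 ^ k) q)
        + V (windowMap d ((n + 1) * 3 ^ k) x) * ψ y' x
        + ∑ z, K (windowMap d ((n + 1) * 3 ^ k) x) (windowMap d ((n + 1) * 3 ^ k) z) * ψ y' z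
        = if siteOf d (3 ^ k) (blk n (windowMap d ((n + 1) * 3 ^ k) x)) = y' then 1 else 0) →
      ∀ (Φ : X d → X d → ℝ) (CΦ : ℝ), (∀ c q, |Φ c q| ≤ CΦ) →
      (∀ c p, ((n : ℝ) + 1) ^ 2 * ∑ μ', (2 * Φ c p - Φ c (p + e μ') - Φ c (p - e μ'))
        + a / ((n : ℝ) + 1) ^ d * ∑ q ∈ B n (blk n p), Φ c q + V p * Φ c p + ∑' q : X d, K p q * Φ c q = if blk n p = c then 1 else 0) →
      ∀ (y y' : Site d (3 ^ k)),
      (∀ q : X d, q ∈ B n (windowMap d (3 ^ k) y) →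
        |ψ y' (siteOf d ((n + 1) * 3 ^ k) q) - Φ (windowMap d (3 ^ k) y') q|
          ≤ ((2 * (CP * (2 * (1 - exp (-(δ₀ - μ)))⁻¹) ^ d) * (2 * (1 - exp (-(μ / 2)))⁻¹) ^ d)
                * (ε * (2 * (1 - exp (-(γ / 2)))⁻¹) ^ d * exp (γ / 2 * d) * CΦ)
              + (2 * (CP * (2 * (1 - exp (-(δ₀ - μ)))⁻¹) ^ d) * (2 * (1 - exp (-(μ / 2)))⁻¹) ^ d)
                * ((2 + 2 * (|lam| + Lam) * (2 * (CP * (2 * (1 - exp (-(δ₀ - μ)))⁻¹) ^ d) * (2 * (1 - exp (-(μ / 2)))⁻¹) ^ d))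
                  * (1 + 2 * (ε * (2 * (1 - exp (-γ))⁻¹) ^ d) * (Bu + CΦ))))
            * exp (-(μ / 2 * max 0 ((((3 ^ k : ℕ) : ℝ) / 2 - 2 - ∑ i, ((((y i).valMinAbs).natAbs : ℕ) : ℝ)) / 2)))) ∧
      |(((n : ℝ) + 1) ^ d)⁻¹ * ∑ z : Fin d → Fin (n + 1), ψ y' (siteOf d ((n + 1) * 3 ^ k) (chart n (windowMap d (3 ^ k) y) z))
          - (((n : ℝ) + 1) ^ d)⁻¹ * ∑ q ∈ B n (windowMap d (3 ^ k) y), Φ (windowMap d (3 ^ k) y') q|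
        ≤ ((2 * (CP * (2 * (1 - exp (-(δ₀ - μ)))⁻¹) ^ d) * (2 * (1 - exp (-(μ / 2)))⁻¹) ^ d)
              * (ε * (2 * (1 - exp (-(γ / 2)))⁻¹) ^ d * exp (γ / 2 * d) * CΦ)
            + (2 * (CP * (2 * (1 - exp (-(δ₀ - μ)))⁻¹) ^ d) * (2 * (1 - exp (-(μ / 2)))⁻¹) ^ d)
              * ((2 + 2 * (|lam| + Lam) * (2 * (CP * (2 * (1 - exp (-(δ₀ - μ)))⁻¹) ^ d) * (2 * (1 - exp (-(μ / 2)))⁻¹) ^ d))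
                * (1 + 2 * (ε * (2 * (1 - exp (-γ))⁻¹) ^ d) * (Bu + CΦ))))
          * exp (-(μ / 2 * max 0 ((((3 ^ k : ℕ) : ℝ) / 2 - 2 - ∑ i, ((((y i).valMinAbs).natAbs : ℕ) : ℝ)) / 2))) := by
  classical
  obtain ⟨C₀, CP, δ₀, hC₀, hCP, hδ₀, H237⟩ := zd_perturbed_data_agreement (d := d) hd a ha hlam hLam
  refine ⟨C₀, CP, δ₀, hC₀, hCP, hδ₀, ?_⟩
  intro n k V hV hV' ε γ μ hε hμ hμδ hμγ hs1 hs2 K hK ψ Bu hψB hψ Φ CΦ hΦB hΦ y y'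
  have hγ : 0 < γ := hμ.trans hμγ
  have hK0 : 0 < (2 * (1 - exp (-(δ₀ - μ)))⁻¹) ^ d := K_pos (d := d) (sub_pos.2 hμδ)
  have hKh : 0 < (2 * (1 - exp (-(μ / 2)))⁻¹) ^ d := K_pos (d := d) (by linarith)
  have hKγ : 0 < (2 * (1 - exp (-γ))⁻¹) ^ d := K_pos (d := d) hγ
  have hKγ2 : 0 < (2 * (1 - exp (-(γ / 2)))⁻¹) ^ d := K_pos (d := d) (by linarith)
  obtain ⟨Cs, hCs⟩ : ∃ Cs : ℝ, Cs = 2 * (CP * (2 * (1 - exp (-(δ₀ - μ)))⁻¹) ^ d) * (2 * (1 - exp (-(μ / 2)))⁻¹) ^ d := ⟨_, rfl⟩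
  obtain ⟨Kγ, hKγd⟩ : ∃ Kγ : ℝ, Kγ = (2 * (1 - exp (-γ))⁻¹) ^ d := ⟨_, rfl⟩
  obtain ⟨E, hE⟩ : ∃ E : ℝ, E = ε * (2 * (1 - exp (-(γ / 2)))⁻¹) ^ d * exp (γ / 2 * d) * CΦ := ⟨_, rfl⟩
  have hCs0 : 0 < Cs := by rw [hCs]; positivity
  have hKγ0 : 0 < Kγ := by rw [hKγd]; exact hKγ
  have hBu : 0 ≤ Bu := (abs_nonneg _).trans (hψB y' 0)
  have hCΦ : 0 ≤ CΦ := (abs_nonneg _).trans (hΦB 0 0)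
  have hE0 : 0 ≤ E := by rw [hE]; positivity
  -- names: the column centre `c = wm y′`, the row block `b₀ = wm y`, the half depth `D₀`
  obtain ⟨c, hc⟩ : ∃ c : X d, c = windowMap d (3 ^ k) y' := ⟨_, rfl⟩
  obtain ⟨b₀, hb₀⟩ : ∃ b₀ : X d, b₀ = windowMap d (3 ^ k) y := ⟨_, rfl⟩
  have hyc : siteOf d (3 ^ k) c = y' := by rw [hc, siteOf_windowMap]
  obtain ⟨D₀, hD₀⟩ : ∃ D₀ : ℝ, D₀ = max 0 ((((3 ^ k : ℕ) : ℝ) / 2 - 2 - ∑ j, (((b₀ j).natAbs : ℕ) : ℝ)) / 2) := ⟨_, rfl⟩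
  have hD₀0 : 0 ≤ D₀ := by rw [hD₀]; exact le_max_left _ _
  have hDy : max 0 ((((3 ^ k : ℕ) : ℝ) / 2 - 2 - ∑ i, ((((y i).valMinAbs).natAbs : ℕ) : ℝ)) / 2) = D₀ := by
    rw [hD₀, hb₀, torusNorm_eq_l1 k y]
  rw [hDy, ← hCs, ← hKγd, ← hE, ← hc, ← hb₀]
  have hV₁ : ∀ p : X d, -lam ≤ V (windowMap d ((n + 1) * 3 ^ k) (siteOf d ((n + 1) * 3 ^ k) p)) := fun p => hV _
  have hV₁' : ∀ p : X d, V (windowMap d ((n + 1) * 3 ^ k) (siteOf d ((n + 1) * 3 ^ k) p)) ≤ Lam := fun p => hV' _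
  have H := H237 n (fun p => V (windowMap d ((n + 1) * 3 ^ k) (siteOf d ((n + 1) * 3 ^ k) p))) V hV₁ hV₁' hV hV' ε γ μ hε hμ hμδ hμγ
    hs1 hs2
  simp only [← hCs] at H
  -- the two truncated-kernel equations ((238)) for the column `y′ = σ c`
  have hψc : ∀ x, ((n : ℝ) + 1) ^ 2 * ∑ μ', (2 * ψ y' x - ψ y' (x + siteOf d ((n + 1) * 3 ^ k) (e μ'))
      - ψ y' (x - siteOf d ((n + 1) * 3 ^ k) (e μ')))
      + a / ((n : ℝ) + 1) ^ d * ∑ q ∈ B n (blk n (windowMap d ((n + 1) * 3 ^ k) x)), ψ y' (siteOf d ((n + 1) * 3 ^ k) q)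
      + (fun x => V (windowMap d ((n + 1) * 3 ^ k) x)) x * ψ y' x
      + ∑ z, K (windowMap d ((n + 1) * 3 ^ k) x) (windowMap d ((n + 1) * 3 ^ k) z) * ψ y' z
      = (fun x => if siteOf d (3 ^ k) (blk n (windowMap d ((n + 1) * 3 ^ k) x)) = siteOf d (3 ^ k) c then (1 : ℝ) else 0) x :=
    fun x => by simp only [hyc]; exact hψ y' x
  obtain ⟨g₁, hg₁W, hg₁B, hu₁⟩ := lift_truncated_equation n a (3 ^ k) hγ K hK (fun x => V (windowMap d ((n + 1) * 3 ^ k) x)) (ψ y')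
    (fun x => if siteOf d (3 ^ k) (blk n (windowMap d ((n + 1) * 3 ^ k) x)) = siteOf d (3 ^ k) c then (1 : ℝ) else 0) (hψB y') hψc
  obtain ⟨hu₂, hg₂B⟩ := column_truncated_equation n a ((n + 1) * 3 ^ k) hγ K hK V (Φ c) (fun p => if blk n p = c then (1 : ℝ) else 0)
    (hΦB c) (hΦ c)
  rw [← hKγd] at hg₁B
  -- the source bounds
  have hf₁ : ∀ p : X d, |(if siteOf d (3 ^ k) (blk n (windowMap d ((n + 1) * 3 ^ k) (siteOf d ((n + 1) * 3 ^ k) p))) = siteOf d (3 ^ k) c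
      then (1 : ℝ) else 0) + g₁ p| ≤ 1 + 2 * (ε * Kγ) * (Bu + CΦ) := by
    intro p
    refine (abs_add_le _ _).trans (add_le_add (by split_ifs <;> simp) ((hg₁B p).trans ?_))
    nlinarith [mul_nonneg (mul_nonneg hε hKγ0.le) hCΦ]
  have hf₂ : ∀ p : X d, |(if blk n p = c then (1 : ℝ) else 0)
      + -∑' q : X d, (if windowMap d ((n + 1) * 3 ^ k) (siteOf d ((n + 1) * 3 ^ k) q) = q then 0 else K p q) * Φ c q|
      ≤ 1 + 2 * (ε * Kγ) * (Bu + CΦ) := by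
    intro p
    have h0 := hg₂B c CΦ 0 0 le_rfl (fun q => by rw [zero_mul, neg_zero, exp_zero, mul_one]; exact hΦB c q) (fun q _ => by positivity) p
    rw [mul_zero, neg_zero, exp_zero, mul_one, ← hKγd] at h0
    refine (abs_add_le _ _).trans (add_le_add (by split_ifs <;> simp) (h0.trans ?_))
    nlinarith [mul_nonneg (mul_nonneg hε hKγ0.le) hBu, mul_nonneg (mul_nonneg hε hKγ0.le) hCΦ]
  -- on the deep blocks of depth `≥ D₀` the potentials agree and the sources are `Ee^{−(γ/2)D₀}`-close
  have hA : ∀ p : X d, blk n p ∈ {b : X d | (∀ i, 2 * |b i| + 4 < ((3 ^ k : ℕ) : ℤ)) ∧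
        D₀ ≤ ((3 ^ k : ℕ) : ℝ) / 2 - 2 - ∑ j, (((b j).natAbs : ℕ) : ℝ)} →
      V (windowMap d ((n + 1) * 3 ^ k) (siteOf d ((n + 1) * 3 ^ k) p)) = V p ∧
      |((if siteOf d (3 ^ k) (blk n (windowMap d ((n + 1) * 3 ^ k) (siteOf d ((n + 1) * 3 ^ k) p))) = siteOf d (3 ^ k) c
          then (1 : ℝ) else 0) + g₁ p)
        - ((if blk n p = c then (1 : ℝ) else 0)
          + -∑' q : X d, (if windowMap d ((n + 1) * 3 ^ k) (siteOf d ((n + 1) * 3 ^ k) q) = q then 0 else K p q) * Φ c q)|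
        ≤ E * exp (-(γ / 2 * D₀)) := by
    intro p hp
    simp only [Set.mem_setOf_eq] at hp
    have hpW := windowMap_siteOf_of_deep_block n k p hp.1
    refine ⟨by rw [hpW], ?_⟩
    have hiff : siteOf d (3 ^ k) (blk n p) = siteOf d (3 ^ k) c ↔ blk n p = c := by
      constructor
      · intro h; rw [← windowMap_siteOf_of_deep k (blk n p) hp.1, h, hyc, hc]
      · intro h; rw [h]
    have hind : (if siteOf d (3 ^ k) (blk n (windowMap d ((n + 1) * 3 ^ k) (siteOf d ((n + 1) * 3 ^ k) p))) = siteOf d (3 ^ k) c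
        then (1 : ℝ) else 0) = if blk n p = c then (1 : ℝ) else 0 := by
      simp only [hpW, hiff]
    rw [hind, hg₁W p hpW]
    have e : (if blk n p = c then (1 : ℝ) else 0) + 0 - ((if blk n p = c then (1 : ℝ) else 0)
        + -∑' q : X d, (if windowMap d ((n + 1) * 3 ^ k) (siteOf d ((n + 1) * 3 ^ k) q) = q then 0 else K p q) * Φ c q)
        = -(-∑' q : X d, (if windowMap d ((n + 1) * 3 ^ k) (siteOf d ((n + 1) * 3 ^ k) q) = q then 0 else K p q) * Φ c q) := by
      ring
    rw [e, abs_neg]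
    refine (truncation_defect_depth n k hε hγ K hK (Φ c) (hΦB c) p).trans ?_
    rw [← hE]
    exact mul_le_mul_of_nonneg_left (exp_le_exp.2 (neg_le_neg (mul_le_mul_of_nonneg_left hp.2 (by linarith)))) hE0
  -- (237) at depth `D₀`
  have key := H (fun p q => if windowMap d ((n + 1) * 3 ^ k) (siteOf d ((n + 1) * 3 ^ k) q) = q then K p q else 0)
    (fun p q => (truncated_kernel_decay ((n + 1) * 3 ^ k) K hK p q).1)
    (fun p => (if siteOf d (3 ^ k) (blk n (windowMap d ((n + 1) * 3 ^ k) (siteOf d ((n + 1) * 3 ^ k) p))) = siteOf d (3 ^ k) c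
      then (1 : ℝ) else 0) + g₁ p)
    (fun p => (if blk n p = c then (1 : ℝ) else 0)
      + -∑' q : X d, (if windowMap d ((n + 1) * 3 ^ k) (siteOf d ((n + 1) * 3 ^ k) q) = q then 0 else K p q) * Φ c q)
    (1 + 2 * (ε * Kγ) * (Bu + CΦ)) hf₁ hf₂ (fun p => ψ y' (siteOf d ((n + 1) * 3 ^ k) p)) (Φ c) Bu CΦ (fun p => hψB y' _) (hΦB c) hu₁ hu₂
    {b : X d | (∀ i, 2 * |b i| + 4 < ((3 ^ k : ℕ) : ℤ)) ∧ D₀ ≤ ((3 ^ k : ℕ) : ℝ) / 2 - 2 - ∑ j, (((b j).natAbs : ℕ) : ℝ)}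
    (E * exp (-(γ / 2 * D₀))) (by positivity) hA
  have hpt : ∀ q : X d, q ∈ B n b₀ → |ψ y' (siteOf d ((n + 1) * 3 ^ k) q) - Φ c q|
      ≤ (Cs * E + Cs * ((2 + 2 * (|lam| + Lam) * Cs) * (1 + 2 * (ε * Kγ) * (Bu + CΦ)))) * exp (-(μ / 2 * D₀)) := by
    intro q hq
    have h := key q D₀ (fun c' hc' => by
      rw [mem_B.1 hq, hD₀]
      refine far_from_shallow k b₀ c' fun h => hc' ?_
      rw [← hD₀] at h
      simpa only [Set.mem_setOf_eq] using h)
    have hexp : exp (-(γ / 2 * D₀)) ≤ exp (-(μ / 2 * D₀)) := exp_le_exp.2 (by nlinarith)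
    calc _ ≤ Cs * (E * exp (-(γ / 2 * D₀))) + Cs * ((2 + 2 * (|lam| + Lam) * Cs) * (1 + 2 * (ε * Kγ) * (Bu + CΦ)))
          * exp (-(μ / 2 * D₀)) := h
      _ ≤ Cs * (E * exp (-(μ / 2 * D₀))) + Cs * ((2 + 2 * (|lam| + Lam) * Cs) * (1 + 2 * (ε * Kγ) * (Bu + CΦ)))
          * exp (-(μ / 2 * D₀)) := by gcongr
      _ = _ := by ring
  refine ⟨hpt, ?_⟩
  -- the coarse entries: average over the block `B n b₀`
  have hvol : (0 : ℝ) < ((n : ℝ) + 1) ^ d := by positivity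
  have esum : ∑ z : Fin d → Fin (n + 1), ψ y' (siteOf d ((n + 1) * 3 ^ k) (chart n b₀ z))
      = ∑ q ∈ B n b₀, ψ y' (siteOf d ((n + 1) * 3 ^ k) q) := (sum_B b₀ (fun q => ψ y' (siteOf d ((n + 1) * 3 ^ k) q))).symm
  rw [esum, ← mul_sub, ← Finset.sum_sub_distrib, abs_mul, abs_of_pos (inv_pos.2 hvol)]
  have hsum : ∑ q ∈ B n b₀, |ψ y' (siteOf d ((n + 1) * 3 ^ k) q) - Φ c q|
      ≤ ∑ _q ∈ B n b₀, (Cs * E + Cs * ((2 + 2 * (|lam| + Lam) * Cs) * (1 + 2 * (ε * Kγ) * (Bu + CΦ)))) * exp (-(μ / 2 * D₀)) :=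
    Finset.sum_le_sum fun q hq => hpt q hq
  rw [sum_B_const] at hsum
  calc (((n : ℝ) + 1) ^ d)⁻¹ * |∑ q ∈ B n b₀, (ψ y' (siteOf d ((n + 1) * 3 ^ k) q) - Φ c q)|
      ≤ (((n : ℝ) + 1) ^ d)⁻¹ * ∑ q ∈ B n b₀, |ψ y' (siteOf d ((n + 1) * 3 ^ k) q) - Φ c q| :=
        mul_le_mul_of_nonneg_left (Finset.abs_sum_le_sum_abs _ _) (inv_nonneg.2 hvol.le)
    _ ≤ (((n : ℝ) + 1) ^ d)⁻¹ * (((n : ℝ) + 1) ^ d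
        * ((Cs * E + Cs * ((2 + 2 * (|lam| + Lam) * Cs) * (1 + 2 * (ε * Kγ) * (Bu + CΦ)))) * exp (-(μ / 2 * D₀)))) :=
        mul_le_mul_of_nonneg_left hsum (inv_nonneg.2 hvol.le)
    _ = _ := by field_simp

/-! ## §3. Toy -/

/-- Toy (`d = 3`, `a = 1`, `λ = 0`, `Λ = 1`): the constants of the row seam estimate exist. -/
example : ∃ C₀ CP δ₀ : ℝ, 0 < C₀ ∧ 0 < CP ∧ 0 < δ₀ :=
  let ⟨C₀, CP, δ₀, h1, h2, h3, _⟩ := zd_perturbed_coarse_seam_row (d := 3) le_rfl 1 one_pos (lam := 0) (Lam := 1)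
    (by rw [min_eq_right (by norm_num : (1 : ℝ) ≤ 2)]; norm_num) zero_le_one
  ⟨C₀, CP, δ₀, h1, h2, h3⟩

end Summit.QuantumFields.BalabanUV.T4Continuum.NE7b.SupZdPerturbedCoarseTorusSeamRow
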